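import Summits.FinalStateConjecture.FinalStateConjecture.Theses.DerivativeThrift
import Summits.FinalStateConjecture.FinalStateConjecture.Theorems.DerivativeThriftThriftyClusterSettlingOuterFlatnessForced
import Summits.FinalStateConjecture.FinalStateConjecture.Theorems.DerivativeThriftThriftyHandoffMinkowskiHandoff
import Summits.FinalStateConjecture.FinalStateConjecture.Theorems.PhotonSphereChannelsChannelsResolveTameDevelopmentsRMinkowskiMaximal
import HarnessLib

/-!
# Restatement package for the planner (lead c4, 2026-08-17) — crux `DerivativeThrift.ThriftyClusterSettling`
# (stmt-FinalStateConjecture-17611) and its three sibling items, as the four line leads and the refuter recommend: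
# layer order `k := 3` (CRUX-ATTACK.md) and Repair B (outer late flat chart bound ONCE in the hand-over, one atlas
# with the late layers; `Lines/registered.lean` Appendix), with the route's deciding theorem RE-PROVED (`closesB₃`).

PLANNER MATERIAL — not route decls, not part of the registered composition.  Every `def` below is a candidate
`--restate` text (fully qualified, route-file style; the bodies were generated from the rev-2 route file by two token
edits — `recedingKerrInitialLayerNorm … 2 (1 / 2) (1 / 2)` ↦ `… 3 (1 / 2) (1 / 2)` — plus, for the hand-over, the
Repair-B block), and every `theorem` is kernel-checked bookkeeping showing what the restatement costs:

* `ThriftyKerrStability₃` (17610 with `k := 3`) is IMPLIED by the filed `ThriftyKerrStability`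
  (`thriftyKerrStability₃_of`: the `k = 3` layer norm dominates the `k = 2` one, `recedingKerrInitialLayerNorm_mono`) —
  a pure weakening of the endgame crux; likewise `ThriftyMinkowskiStability₃` (17613).  (The linear-radii / gauge-tie
  sharpening of their CONCLUSIONS recommended in `Lines/registered-dead-c3.md` §4 is not attempted here: it is a
  design decision for the 17610/17613 leads.)
* `ThriftyClusterSettlingB₃` (17611, Repair B, `k := 3`): hypothesis `ThriftyKerrStability₃`; antecedent = the filed
  hand-over PLUS one outer late flat chart `Φₑ` on a cone complement `{x⁰ > τₑ, |x̲| > (1 − θ) x⁰}` (late chart into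
  `J⁺(ι X)`, full-slab `C²` deviation `→ 0`, `∂₀` eventually future-directed) and the ONE-ATLAS tie (every late layer
  chart coincides with `Φₑ` at its points in the cone complement), layers `ε`-thrifty at order `3`; consequent
  unchanged.  It follows from `RepairA₃` (`thriftyClusterSettlingB₃_of_repairA₃`), i.e. from the registered line's
  stub 1' re-typed to (`ThriftyKerrStability₃`, order-3 hand-over) plus the LANDED stub 3' (p145999) — the line
  survives the restatement with its one analytic stub, and `stub_outerZoneFlatness` disappears.
* `ThriftyHandoffB₃` (17612): clause (iii) replaced by the Repair-B antecedent verbatim (so `closesB₃` is syntactic);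
  it IMPLIES the filed `ThriftyHandoff` (`thriftyHandoff_of_B₃`: forget the outer chart and the tie, weaken the order) —
  the large-data side is asked for strictly more, which is where the outer zone belongs (exterior stability / `i⁰`
  corner is a property of the datum's development, generic or not, never of the near-zone endgame).
* `closesB₃ : ThriftyKerrStability₃ → ThriftyClusterSettlingB₃ → ThriftyHandoffB₃ → FinalStateConjecture` — the
  deciding theorem re-proved with the same 15-line glue as the route's `closes`.
* `repairBHandover₃_minkowski`, `restatedCruxHypotheses_and_consequent_minkowski` — ANTI-VACUITY of the restated
  crux: its whole hypothesis block (incl. the Repair-B order-3 hand-over: identity outer chart, exact `0`-hole layers,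
  tie by `rfl`) holds together with its conclusion at the Minkowski development (maximality given
  `choquetBruhat_geroch_exists_mghd_cauchy`).

NOT ADDRESSED HERE (the planner should merge these when restating — they are independent of Repair B / `k := 3`):
* (c3 dossier `Lines/registered-dead-c3.md` §4) the restated crux's one analytic stub is provable from the endgame items only
  if 17610/17613 conclude with LINEAR radii `R(σ) = (1 − θ)σ` and in a gauge TIED to the outer chart `Φₑ` (rate-free `C²`
  closeness on scale-`σ` bands does not pin the transition map to one Poincaré map), or if the hand-over delivers the whole
  radiation-zone flat chart and the crux keeps only near zones + seam + bookkeeping;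
* (cross-route notes of lead c14 of crux `LinearToNonlinearCapture`, stmt-FinalStateConjecture-14526, attached to this item
  2026-08-17T10:08Z / 10:57Z) (F2) far-field swarms never meet any hyperboloidal layer, so NO thrift order cures the outer-zone
  defect — only an outer chart in the hand-over (Repair B) does, `k := 3` cures the near-zone cap trains (F1) only; (D1) the
  hand-over's near `Cᵏ` part `RecedingKerr.nearLayer` is the cylinder `{|x̲| ≤ ℓ}` about the chart ORIGIN while the centres `ξᵢ`
  are unbounded and `ε⁻¹`-separated at fixed `ℓ`, so for `ε < 1/(2ℓ)` at most one hole is sup-controlled — c14's minimal monotone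
  repair adds per-hole RE-CENTRED layer charts `Φᵢ : RecedingKerr.layer M a Λ (fun j ↦ ξ j - ξ i) τ ℓ → 𝒟.carrier` with the same
  five clauses and centred norm `≤ ε` (their skeleton v2.1 text elaborates rc 0); (D2) `ThriftyKerrStability`'s `Fin 1` layer
  excises only its own core, so inside an `N ≥ 2` development its unbounded far leaves cannot be `ε`-thrifty — TKS applies per
  hole only to auxiliary glued single-hole developments (domain of dependence over the decoupling window), a gluing step that is
  part of this crux's content and may deserve its own item.

Dafermos–Luk arXiv:1710.01722, Conjecture 1; Klainerman–Szeftel arXiv:2104.11857, §3.6; DHRT arXiv:2104.08222, §1;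
Bieri, J. Differential Geom. 86 (2010) (order `k = 3` = curvature + 1 derivative in flux form).
-/

noncomputable section

namespace Summit.FinalStateConjecture.FinalStateConjecture.Cruxes.ThriftyClusterSettling.Restatement

open scoped BigOperators Topology Manifold Classical MeasureTheory ProbabilityTheory Matrix InnerProductSpace ComplexConjugate ContinuousMap
open Filter Set Function TopologicalSpace MeasureTheory

set_option linter.dupNamespace false
set_option linter.unusedVariables false

/-- **`ThriftyKerrStability` with layer order `k := 3`** (candidate restatement of stmt-FinalStateConjecture-17610; one
token changed: the layer norm is `𝔑_(3,1/2,1/2)`).  [cite: KlainermanSzeftel2023, §3.6] -/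
def ThriftyKerrStability₃ : Prop :=
  ∀ (M₀ a₀ : ℝ), Literature.Geometry.Lorentzian.Kerr.IsSubextremal M₀ a₀ → ∀ ℓ : ℝ, 4 * M₀ ≤ ℓ → ∀ η : ℝ, 0 < η → ∃ ε : ℝ, 0 < ε ∧ ∀ (X : Type) [TopologicalSpace X] [ChartedSpace Literature.Geometry.Lorentzian.E3 X] [IsManifold (𝓡 3) ((⊤ : ℕ∞) : WithTop ℕ∞) X] [T2Space X] [SecondCountableTopology X] [ConnectedSpace X] (D : Literature.Geometry.Lorentzian.InitialDataSet (𝓡 3) X), D ∈ Literature.Geometry.Lorentzian.admissibleVacuumData X → ∀ 𝒟 : Literature.Geometry.Lorentzian.VacuumCauchyDevelopment D, 𝒟.IsMaximal → ∀ (τ : ℝ) (Φ : Literature.Geometry.Lorentzian.RecedingKerr.layer (fun _ : Fin 1 ↦ M₀) (fun _ ↦ a₀) (fun _ ↦ 1) (fun _ ↦ 0) τ ℓ → 𝒟.carrier), ContMDiff 𝓘(ℝ, Literature.Geometry.Lorentzian.E4) (𝓡 4) ((⊤ : ℕ∞) : WithTop ℕ∞) Φ → Topology.IsOpenEmbedding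 Φ → Set.range Φ ⊆ 𝒟.metric.causalFuture 𝒟.timeOrientation (Set.range 𝒟.embed) → (∀ s₀ ∈ Set.Ioo 0 ℓ, 𝒟.metric.IsAchronal 𝒟.timeOrientation (Φ '' {x | Literature.Geometry.Lorentzian.RecedingKerr.layerTime τ ℓ x.1 = s₀})) → 𝒟.toSpacetime.recedingKerrInitialLayerNorm (fun _ : Fin 1 ↦ M₀) (fun _ ↦ a₀) (fun _ ↦ 1) (fun _ ↦ 0) τ ℓ 3 (1 / 2) (1 / 2) Φ ≤ ENNReal.ofReal ε → ∃ (M' a' τ' : ℝ) (Ψ : (Literature.Geometry.Lorentzian.Kerr.background M' a').domain → 𝒟.carrier) (R : ℝ → ℝ), Literature.Geometry.Lorentzian.Kerr.IsSubextremal M' a' ∧ |M' - M₀| + |a' - a₀| ≤ η ∧ 𝒟.toSpacetime.IsLateChart (Literature.Geometry.Lorentzian.Kerr.background M' a') (𝒟.metric.causalFuture 𝒟.timeOrientation (Set.range Φ)) τ' Ψ ∧ Filter.Tendsto R Filter.atTop Filter.atTop ∧ Filter.Tendsto (fun σ ↦ 𝒟.toSpacetime.truncDeviationCk (Literature.Geometry.Lorentzian.Kerr.background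 M' a') Ψ 2 (R σ) σ) Filter.atTop (nhds 0) ∧ ∀ ρ : ℝ, ∀ᶠ σ in Filter.atTop, ∀ x ∈ (Literature.Geometry.Lorentzian.Kerr.background M' a').truncTimeSlab ρ σ, 𝒟.timeOrientation.IsFutureDirected (mfderiv 𝓘(ℝ, Literature.Geometry.Lorentzian.E4) (𝓡 4) Ψ x (Literature.Geometry.Lorentzian.Kerr.timeVector M' a' (x : Literature.Geometry.Lorentzian.E4)))

/-- **`ThriftyMinkowskiStability` with layer order `k := 3`** (candidate restatement of stmt-FinalStateConjecture-17613;
Bieri's curvature + 1 derivative level in layer form).  [cite: Bieri2010JDG, Thm. 1] -/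
def ThriftyMinkowskiStability₃ : Prop :=
  ∀ ℓ : ℝ, 0 < ℓ → ∃ ε : ℝ, 0 < ε ∧ ∀ (X : Type) [TopologicalSpace X] [ChartedSpace Literature.Geometry.Lorentzian.E3 X] [IsManifold (𝓡 3) ((⊤ : ℕ∞) : WithTop ℕ∞) X] [T2Space X] [SecondCountableTopology X] [ConnectedSpace X] (D : Literature.Geometry.Lorentzian.InitialDataSet (𝓡 3) X), D ∈ Literature.Geometry.Lorentzian.admissibleVacuumData X → ∀ 𝒟 : Literature.Geometry.Lorentzian.VacuumCauchyDevelopment D, 𝒟.IsMaximal → ∀ (τ : ℝ) (Φ : Literature.Geometry.Lorentzian.RecedingKerr.layer (![] : Fin 0 → ℝ) (![] : Fin 0 → ℝ) (![] : Fin 0 → ↥Literature.Geometry.Lorentzian.lorentzGroup) (![] : Fin 0 → Literature.Geometry.Lorentzian.E3) τ ℓ → 𝒟.carrier), ContMDiff 𝓘(ℝ, Literature.Geometry.Lorentzian.E4) (𝓡 4) ((⊤ : ℕ∞) : WithTop ℕ∞) Φ → Topology.IsOpenEmbedding Φ → Set.range Φ ⊆ 𝒟.metric.causalFuture 𝒟.timeOrientation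 (Set.range 𝒟.embed) → (∀ s₀ ∈ Set.Ioo 0 ℓ, 𝒟.metric.IsAchronal 𝒟.timeOrientation (Φ '' {x | Literature.Geometry.Lorentzian.RecedingKerr.layerTime τ ℓ x.1 = s₀})) → 𝒟.toSpacetime.recedingKerrInitialLayerNorm (![] : Fin 0 → ℝ) (![] : Fin 0 → ℝ) (![] : Fin 0 → ↥Literature.Geometry.Lorentzian.lorentzGroup) (![] : Fin 0 → Literature.Geometry.Lorentzian.E3) τ ℓ 3 (1 / 2) (1 / 2) Φ ≤ ENNReal.ofReal ε → ∃ (τ' : ℝ) (Ψ : Literature.Geometry.Lorentzian.Minkowski.background.domain → 𝒟.carrier) (R : ℝ → ℝ), 𝒟.toSpacetime.IsLateChart Literature.Geometry.Lorentzian.Minkowski.background (𝒟.metric.causalFuture 𝒟.timeOrientation (Set.range Φ)) τ' Ψ ∧ Filter.Tendsto R Filter.atTop Filter.atTop ∧ Filter.Tendsto (fun σ ↦ 𝒟.toSpacetime.truncDeviationCk Literature.Geometry.Lorentzian.Minkowski.background Ψ 2 (R σ) σ) Filter.atTop (nhds 0) ∧ ∀ ρ : ℝ, ∀ᶠ σ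 in Filter.atTop, ∀ x ∈ Literature.Geometry.Lorentzian.Minkowski.background.truncTimeSlab ρ σ, 𝒟.timeOrientation.IsFutureDirected (mfderiv 𝓘(ℝ, Literature.Geometry.Lorentzian.E4) (𝓡 4) Ψ x (Literature.Geometry.Lorentzian.E4.basisVector 0))

/-- **`ThriftyClusterSettling`, Repair B, layer order `k := 3`** (candidate restatement of stmt-FinalStateConjecture-17611):
granted `ThriftyKerrStability₃`, for every admissible datum and MGHD with complete `𝓘⁺`, IF there are `N`, sub-extremal
labels, orthochronous motions with distinct velocities, ONE outer late flat chart `Φₑ` on a cone complement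
`{x⁰ > τₑ, |x̲| > (1 − θ) x⁰}` (into `J⁺(ι X)`, `C²` deviation `→ 0`, `∂₀` eventually future-directed) and, for every
`ℓ, ε, τ₁`, a late separating `ε`-thrifty (order 3) `N`-hole layer chart AGREEING with `Φₑ` on the cone complement, THEN
the exterior settles in the re-typed sense (consequent unchanged).  [cite: DafermosLuk2017, Conjecture 1] -/
def ThriftyClusterSettlingB₃ : Prop :=
  ThriftyKerrStability₃ → ∀ (X : Type) [TopologicalSpace X] [ChartedSpace Literature.Geometry.Lorentzian.E3 X] [IsManifold (𝓡 3) ((⊤ : ℕ∞) : WithTop ℕ∞) X] [T2Space X] [SecondCountableTopology X] [ConnectedSpace X] (D : Literature.Geometry.Lorentzian.InitialDataSet (𝓡 3) X), D ∈ Literature.Geometry.Lorentzian.admissibleVacuumData X → ∀ 𝒟 : Literature.Geometry.Lorentzian.VacuumCauchyDevelopment D, 𝒟.IsMaximal → Summit.FinalStateConjecture.HasCompleteNullInfinity 𝒟.toCauchyDevelopment → (∃ (N : ℕ) (M a : Fin N → ℝ) (Λ : Fin N → ↥Literature.Geometry.Lorentzian.lorentzGroup), (∀ i, Literature.Geometry.Lorentzian.Kerr.IsSubextremal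 (M i) (a i)) ∧ (∀ i, Summit.FinalStateConjecture.IsOrthochronous (Λ i)) ∧ (∀ i j, i ≠ j → (((Λ i : Literature.Geometry.Lorentzian.E4 ≃L[ℝ] Literature.Geometry.Lorentzian.E4) (Literature.Geometry.Lorentzian.E4.basisVector 0)) 0)⁻¹ • Literature.Geometry.Lorentzian.E4.spatial ((Λ i : Literature.Geometry.Lorentzian.E4 ≃L[ℝ] Literature.Geometry.Lorentzian.E4) (Literature.Geometry.Lorentzian.E4.basisVector 0)) ≠ (((Λ j : Literature.Geometry.Lorentzian.E4 ≃L[ℝ] Literature.Geometry.Lorentzian.E4) (Literature.Geometry.Lorentzian.E4.basisVector 0)) 0)⁻¹ • Literature.Geometry.Lorentzian.E4.spatial ((Λ j : Literature.Geometry.Lorentzian.E4 ≃L[ℝ] Literature.Geometry.Lorentzian.E4) (Literature.Geometry.Lorentzian.E4.basisVector 0))) ∧ ∃ (θ τₑ : ℝ) (V : TopologicalSpace.Opens Literature.Geometry.Lorentzian.E4) (Φₑ : V → 𝒟.carrier), 0 < θ ∧ {x : Literature.Geometry.Lorentzian.E4 | τₑ < x 0 ∧ (1 - θ) * x 0 <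 Literature.Geometry.Lorentzian.E4.spatialNorm x} ⊆ (V : Set Literature.Geometry.Lorentzian.E4) ∧ 𝒟.toSpacetime.IsLateChart (Literature.Geometry.Lorentzian.Minkowski.backgroundOn V) (𝒟.metric.causalFuture 𝒟.timeOrientation (Set.range 𝒟.embed)) τₑ Φₑ ∧ Filter.Tendsto (fun τ ↦ 𝒟.toSpacetime.deviationCk (Literature.Geometry.Lorentzian.Minkowski.backgroundOn V) Φₑ 2 τ) Filter.atTop (nhds 0) ∧ (∀ᶠ τ in Filter.atTop, ∀ x ∈ (Literature.Geometry.Lorentzian.Minkowski.backgroundOn V).timeSlab τ, 𝒟.timeOrientation.IsFutureDirected (mfderiv 𝓘(ℝ, Literature.Geometry.Lorentzian.E4) (𝓡 4) Φₑ x (Literature.Geometry.Lorentzian.E4.basisVector 0))) ∧ ∀ ℓ : ℝ, 0 < ℓ → ∀ ε : ℝ, 0 < ε → ∀ τ₁ : ℝ, ∃ τ : ℝ, τ₁ ≤ τ ∧ ∃ (ξ : Fin N → Literature.Geometry.Lorentzian.E3) (Φ : Literature.Geometry.Lorentzian.RecedingKerr.layer M a Λ ξ τ ℓ → 𝒟.carrier),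 (∀ i j, i ≠ j → ε⁻¹ ≤ ‖ξ i - ξ j‖ ∧ 0 ≤ @inner ℝ Literature.Geometry.Lorentzian.E3 _ (ξ i - ξ j) ( (((Λ i : Literature.Geometry.Lorentzian.E4 ≃L[ℝ] Literature.Geometry.Lorentzian.E4) (Literature.Geometry.Lorentzian.E4.basisVector 0)) 0)⁻¹ • Literature.Geometry.Lorentzian.E4.spatial ((Λ i : Literature.Geometry.Lorentzian.E4 ≃L[ℝ] Literature.Geometry.Lorentzian.E4) (Literature.Geometry.Lorentzian.E4.basisVector 0)) - (((Λ j : Literature.Geometry.Lorentzian.E4 ≃L[ℝ] Literature.Geometry.Lorentzian.E4) (Literature.Geometry.Lorentzian.E4.basisVector 0)) 0)⁻¹ • Literature.Geometry.Lorentzian.E4.spatial ((Λ j : Literature.Geometry.Lorentzian.E4 ≃L[ℝ] Literature.Geometry.Lorentzian.E4) (Literature.Geometry.Lorentzian.E4.basisVector 0)))) ∧ ContMDiff 𝓘(ℝ, Literature.Geometry.Lorentzian.E4) (𝓡 4) ((⊤ : ℕ∞) : WithTop ℕ∞) Φ ∧ Topology.IsOpenEmbedding Φ ∧ Set.range Φ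 ⊆ 𝒟.metric.causalFuture 𝒟.timeOrientation (Set.range 𝒟.embed) ∧ (∀ s₀ ∈ Set.Ioo 0 ℓ, 𝒟.metric.IsAchronal 𝒟.timeOrientation (Φ '' {x | Literature.Geometry.Lorentzian.RecedingKerr.layerTime τ ℓ x.1 = s₀})) ∧ 𝒟.toSpacetime.recedingKerrInitialLayerNorm M a Λ ξ τ ℓ 3 (1 / 2) (1 / 2) Φ ≤ ENNReal.ofReal ε ∧ (∀ x : Literature.Geometry.Lorentzian.RecedingKerr.layer M a Λ ξ τ ℓ, τₑ < x.1 0 → (1 - θ) * x.1 0 < Literature.Geometry.Lorentzian.E4.spatialNorm x.1 → ∃ hx : x.1 ∈ V, Φ x = Φₑ ⟨x.1, hx⟩)) → ∃ (O : Set 𝒟.carrier) (d : Literature.Geometry.Lorentzian.FinalStateDecomposition 𝒟.toSpacetime O 2), (∀ i, Literature.Geometry.Lorentzian.Kerr.IsSubextremal (d.mass i) (d.spin i)) ∧ O = Summit.FinalStateConjecture.exteriorOf 𝒟.toCauchyDevelopment d.charted ∧ Summit.FinalStateConjecture.HasExhaustiveCharts d ∧ Summit.FinalStateConjecture.IsFutureOriented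 d

/-- **`ThriftyHandoff` with clause (iii) in Repair-B form, layer order `k := 3`** (candidate restatement of
stmt-FinalStateConjecture-17612): tame-Christodoulou-generically, an MGHD exists and every MGHD has complete `𝓘⁺`,
captures rays, and admits the Repair-B hand-over (outer late flat chart + one-atlas order-3 thrifty layers) —
verbatim the antecedent of `ThriftyClusterSettlingB₃`.  [cite: DafermosLuk2017, Conjecture 1] -/
def ThriftyHandoffB₃ : Prop :=
  ∀ (X : Type) [TopologicalSpace X] [ChartedSpace Literature.Geometry.Lorentzian.E3 X] [IsManifold (𝓡 3) ((⊤ : ℕ∞) : WithTop ℕ∞) X] [T2Space X] [SecondCountableTopology X] [ConnectedSpace X], Literature.Geometry.Lorentzian.InitialDataSet.IsTameChristodoulouGeneric (Literature.Geometry.Lorentzian.admissibleVacuumData X) (fun D ↦ (∃ 𝒟 : Literature.Geometry.Lorentzian.VacuumCauchyDevelopment D, 𝒟.IsMaximal) ∧ ∀ 𝒟 : Literature.Geometry.Lorentzian.VacuumCauchyDevelopment D, 𝒟.IsMaximal → Summit.FinalStateConjecture.HasCompleteNullInfinity 𝒟.toCauchyDevelopment ∧ (∀ (O : Set 𝒟.carrier)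 (d : Literature.Geometry.Lorentzian.FinalStateDecomposition 𝒟.toSpacetime O 2), (∀ i, Literature.Geometry.Lorentzian.Kerr.IsSubextremal (d.mass i) (d.spin i)) → O = Summit.FinalStateConjecture.exteriorOf 𝒟.toCauchyDevelopment d.charted → Summit.FinalStateConjecture.HasExhaustiveCharts d → Summit.FinalStateConjecture.IsFutureOriented d → Summit.FinalStateConjecture.RaysStayInClosure 𝒟.toCauchyDevelopment O) ∧ (∃ (N : ℕ) (M a : Fin N → ℝ) (Λ : Fin N → ↥Literature.Geometry.Lorentzian.lorentzGroup), (∀ i, Literature.Geometry.Lorentzian.Kerr.IsSubextremal (M i) (a i)) ∧ (∀ i, Summit.FinalStateConjecture.IsOrthochronous (Λ i)) ∧ (∀ i j, i ≠ j → (((Λ i : Literature.Geometry.Lorentzian.E4 ≃L[ℝ] Literature.Geometry.Lorentzian.E4) (Literature.Geometry.Lorentzian.E4.basisVector 0)) 0)⁻¹ • Literature.Geometry.Lorentzian.E4.spatial ((Λ i : Literature.Geometry.Lorentzian.E4 ≃L[ℝ] Literature.Geometry.Lorentzian.E4) (Literature.Geometry.Lorentzian.E4.basisVector 0)) ≠ (((Λ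 j : Literature.Geometry.Lorentzian.E4 ≃L[ℝ] Literature.Geometry.Lorentzian.E4) (Literature.Geometry.Lorentzian.E4.basisVector 0)) 0)⁻¹ • Literature.Geometry.Lorentzian.E4.spatial ((Λ j : Literature.Geometry.Lorentzian.E4 ≃L[ℝ] Literature.Geometry.Lorentzian.E4) (Literature.Geometry.Lorentzian.E4.basisVector 0))) ∧ ∃ (θ τₑ : ℝ) (V : TopologicalSpace.Opens Literature.Geometry.Lorentzian.E4) (Φₑ : V → 𝒟.carrier), 0 < θ ∧ {x : Literature.Geometry.Lorentzian.E4 | τₑ < x 0 ∧ (1 - θ) * x 0 < Literature.Geometry.Lorentzian.E4.spatialNorm x} ⊆ (V : Set Literature.Geometry.Lorentzian.E4) ∧ 𝒟.toSpacetime.IsLateChart (Literature.Geometry.Lorentzian.Minkowski.backgroundOn V) (𝒟.metric.causalFuture 𝒟.timeOrientation (Set.range 𝒟.embed)) τₑ Φₑ ∧ Filter.Tendsto (fun τ ↦ 𝒟.toSpacetime.deviationCk (Literature.Geometry.Lorentzian.Minkowski.backgroundOn V) Φₑ 2 τ) Filter.atTop (nhds 0) ∧ (∀ᶠ τ in Filter.atTop,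 ∀ x ∈ (Literature.Geometry.Lorentzian.Minkowski.backgroundOn V).timeSlab τ, 𝒟.timeOrientation.IsFutureDirected (mfderiv 𝓘(ℝ, Literature.Geometry.Lorentzian.E4) (𝓡 4) Φₑ x (Literature.Geometry.Lorentzian.E4.basisVector 0))) ∧ ∀ ℓ : ℝ, 0 < ℓ → ∀ ε : ℝ, 0 < ε → ∀ τ₁ : ℝ, ∃ τ : ℝ, τ₁ ≤ τ ∧ ∃ (ξ : Fin N → Literature.Geometry.Lorentzian.E3) (Φ : Literature.Geometry.Lorentzian.RecedingKerr.layer M a Λ ξ τ ℓ → 𝒟.carrier), (∀ i j, i ≠ j → ε⁻¹ ≤ ‖ξ i - ξ j‖ ∧ 0 ≤ @inner ℝ Literature.Geometry.Lorentzian.E3 _ (ξ i - ξ j) ( (((Λ i : Literature.Geometry.Lorentzian.E4 ≃L[ℝ] Literature.Geometry.Lorentzian.E4) (Literature.Geometry.Lorentzian.E4.basisVector 0)) 0)⁻¹ • Literature.Geometry.Lorentzian.E4.spatial ((Λ i : Literature.Geometry.Lorentzian.E4 ≃L[ℝ] Literature.Geometry.Lorentzian.E4) (Literature.Geometry.Lorentzian.E4.basisVector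 0)) - (((Λ j : Literature.Geometry.Lorentzian.E4 ≃L[ℝ] Literature.Geometry.Lorentzian.E4) (Literature.Geometry.Lorentzian.E4.basisVector 0)) 0)⁻¹ • Literature.Geometry.Lorentzian.E4.spatial ((Λ j : Literature.Geometry.Lorentzian.E4 ≃L[ℝ] Literature.Geometry.Lorentzian.E4) (Literature.Geometry.Lorentzian.E4.basisVector 0)))) ∧ ContMDiff 𝓘(ℝ, Literature.Geometry.Lorentzian.E4) (𝓡 4) ((⊤ : ℕ∞) : WithTop ℕ∞) Φ ∧ Topology.IsOpenEmbedding Φ ∧ Set.range Φ ⊆ 𝒟.metric.causalFuture 𝒟.timeOrientation (Set.range 𝒟.embed) ∧ (∀ s₀ ∈ Set.Ioo 0 ℓ, 𝒟.metric.IsAchronal 𝒟.timeOrientation (Φ '' {x | Literature.Geometry.Lorentzian.RecedingKerr.layerTime τ ℓ x.1 = s₀})) ∧ 𝒟.toSpacetime.recedingKerrInitialLayerNorm M a Λ ξ τ ℓ 3 (1 / 2) (1 / 2) Φ ≤ ENNReal.ofReal ε ∧ (∀ x : Literature.Geometry.Lorentzian.RecedingKerr.layer M a Λ ξ τ ℓ,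 τₑ < x.1 0 → (1 - θ) * x.1 0 < Literature.Geometry.Lorentzian.E4.spatialNorm x.1 → ∃ hx : x.1 ∈ V, Φ x = Φₑ ⟨x.1, hx⟩))) 1

/-- **Repair A at order 3** (the registered line's target after restatement: hand-over of order 3 and an outer-flatness
certificate as two separate hypotheses; what stub 1' re-typed + the landed stub 3' prove).  [cite: DafermosLuk2017, Conjecture 1] -/
def RepairA₃ : Prop :=
  ThriftyKerrStability₃ → ∀ (X : Type) [TopologicalSpace X] [ChartedSpace Literature.Geometry.Lorentzian.E3 X] [IsManifold (𝓡 3) ((⊤ : ℕ∞) : WithTop ℕ∞) X] [T2Space X] [SecondCountableTopology X] [ConnectedSpace X] (D : Literature.Geometry.Lorentzian.InitialDataSet (𝓡 3) X), D ∈ Literature.Geometry.Lorentzian.admissibleVacuumData X → ∀ 𝒟 : Literature.Geometry.Lorentzian.VacuumCauchyDevelopment D, 𝒟.IsMaximal → Summit.FinalStateConjecture.HasCompleteNullInfinity 𝒟.toCauchyDevelopment → (∃ (N : ℕ) (M a : Fin N → ℝ) (Λ : Fin N → ↥Literature.Geometry.Lorentzian.lorentzGroup), (∀ i, Literature.Geometry.Lorentzian.Kerr.IsSubextremal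 (M i) (a i)) ∧ (∀ i, Summit.FinalStateConjecture.IsOrthochronous (Λ i)) ∧ (∀ i j, i ≠ j → (((Λ i : Literature.Geometry.Lorentzian.E4 ≃L[ℝ] Literature.Geometry.Lorentzian.E4) (Literature.Geometry.Lorentzian.E4.basisVector 0)) 0)⁻¹ • Literature.Geometry.Lorentzian.E4.spatial ((Λ i : Literature.Geometry.Lorentzian.E4 ≃L[ℝ] Literature.Geometry.Lorentzian.E4) (Literature.Geometry.Lorentzian.E4.basisVector 0)) ≠ (((Λ j : Literature.Geometry.Lorentzian.E4 ≃L[ℝ] Literature.Geometry.Lorentzian.E4) (Literature.Geometry.Lorentzian.E4.basisVector 0)) 0)⁻¹ • Literature.Geometry.Lorentzian.E4.spatial ((Λ j : Literature.Geometry.Lorentzian.E4 ≃L[ℝ] Literature.Geometry.Lorentzian.E4) (Literature.Geometry.Lorentzian.E4.basisVector 0))) ∧ ∀ ℓ : ℝ, 0 < ℓ → ∀ ε : ℝ, 0 < ε → ∀ τ₁ : ℝ, ∃ τ : ℝ, τ₁ ≤ τ ∧ ∃ (ξ : Fin N → Literature.Geometry.Lorentzian.E3) (Φ : Literature.Geometry.Lorentzian.RecedingKerr.layer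 M a Λ ξ τ ℓ → 𝒟.carrier), (∀ i j, i ≠ j → ε⁻¹ ≤ ‖ξ i - ξ j‖ ∧ 0 ≤ @inner ℝ Literature.Geometry.Lorentzian.E3 _ (ξ i - ξ j) ( (((Λ i : Literature.Geometry.Lorentzian.E4 ≃L[ℝ] Literature.Geometry.Lorentzian.E4) (Literature.Geometry.Lorentzian.E4.basisVector 0)) 0)⁻¹ • Literature.Geometry.Lorentzian.E4.spatial ((Λ i : Literature.Geometry.Lorentzian.E4 ≃L[ℝ] Literature.Geometry.Lorentzian.E4) (Literature.Geometry.Lorentzian.E4.basisVector 0)) - (((Λ j : Literature.Geometry.Lorentzian.E4 ≃L[ℝ] Literature.Geometry.Lorentzian.E4) (Literature.Geometry.Lorentzian.E4.basisVector 0)) 0)⁻¹ • Literature.Geometry.Lorentzian.E4.spatial ((Λ j : Literature.Geometry.Lorentzian.E4 ≃L[ℝ] Literature.Geometry.Lorentzian.E4) (Literature.Geometry.Lorentzian.E4.basisVector 0)))) ∧ ContMDiff 𝓘(ℝ, Literature.Geometry.Lorentzian.E4) (𝓡 4) ((⊤ : ℕ∞) : WithTop ℕ∞) Φ ∧ Topology.IsOpenEmbedding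 Φ ∧ Set.range Φ ⊆ 𝒟.metric.causalFuture 𝒟.timeOrientation (Set.range 𝒟.embed) ∧ (∀ s₀ ∈ Set.Ioo 0 ℓ, 𝒟.metric.IsAchronal 𝒟.timeOrientation (Φ '' {x | Literature.Geometry.Lorentzian.RecedingKerr.layerTime τ ℓ x.1 = s₀})) ∧ 𝒟.toSpacetime.recedingKerrInitialLayerNorm M a Λ ξ τ ℓ 3 (1 / 2) (1 / 2) Φ ≤ ENNReal.ofReal ε) → (∃ (θ τₑ : ℝ) (V : TopologicalSpace.Opens Literature.Geometry.Lorentzian.E4) (Φₑ : V → 𝒟.carrier), 0 < θ ∧ {x : Literature.Geometry.Lorentzian.E4 | τₑ < x 0 ∧ (1 - θ) * x 0 < Literature.Geometry.Lorentzian.E4.spatialNorm x} ⊆ (V : Set Literature.Geometry.Lorentzian.E4) ∧ 𝒟.toSpacetime.IsLateChart (Literature.Geometry.Lorentzian.Minkowski.backgroundOn V) (𝒟.metric.causalFuture 𝒟.timeOrientation (Set.range 𝒟.embed)) τₑ Φₑ ∧ Filter.Tendsto (fun τ ↦ 𝒟.toSpacetime.deviationCk (Literature.Geometry.Lorentzian.Minkowski.backgroundOn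 V) Φₑ 2 τ) Filter.atTop (nhds 0) ∧ ∀ᶠ τ in Filter.atTop, ∀ x ∈ (Literature.Geometry.Lorentzian.Minkowski.backgroundOn V).timeSlab τ, 𝒟.timeOrientation.IsFutureDirected (mfderiv 𝓘(ℝ, Literature.Geometry.Lorentzian.E4) (𝓡 4) Φₑ x (Literature.Geometry.Lorentzian.E4.basisVector 0))) → ∃ (O : Set 𝒟.carrier) (d : Literature.Geometry.Lorentzian.FinalStateDecomposition 𝒟.toSpacetime O 2), (∀ i, Literature.Geometry.Lorentzian.Kerr.IsSubextremal (d.mass i) (d.spin i)) ∧ O = Summit.FinalStateConjecture.exteriorOf 𝒟.toCauchyDevelopment d.charted ∧ Summit.FinalStateConjecture.HasExhaustiveCharts d ∧ Summit.FinalStateConjecture.IsFutureOriented d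

/-- The filed `ThriftyKerrStability` (order 2) implies its order-3 restatement: an order-3-thrifty layer is order-2-thrifty
(`recedingKerrInitialLayerNorm_mono`).  [cite: KlainermanSzeftel2023, §3.6] -/
theorem thriftyKerrStability₃_of (h : Theses.DerivativeThrift.ThriftyKerrStability) : ThriftyKerrStability₃ := by
  intro M₀ a₀ hsub ℓ hℓ η hη
  obtain ⟨ε, hε, H⟩ := h M₀ a₀ hsub ℓ hℓ η hη
  refine ⟨ε, hε, fun X _ _ _ _ _ _ D hD 𝒟 h𝒟 τ Φ hsm hemb hJ hach hnorm ↦ ?_⟩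
  exact H X D hD 𝒟 h𝒟 τ Φ hsm hemb hJ hach
    ((Literature.Geometry.Lorentzian.Spacetime.recedingKerrInitialLayerNorm_mono _ _ _ _ _ _ _
      (by norm_num : (2 : ℕ) ≤ 3) _ _ Φ).trans hnorm)

/-- The filed `ThriftyMinkowskiStability` (order 2) implies its order-3 restatement.  [cite: Bieri2010JDG, Thm. 1] -/
theorem thriftyMinkowskiStability₃_of (h : Theses.DerivativeThrift.ThriftyMinkowskiStability) :
    ThriftyMinkowskiStability₃ := by
  intro ℓ hℓ
  obtain ⟨ε, hε, H⟩ := h ℓ hℓ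
  refine ⟨ε, hε, fun X _ _ _ _ _ _ D hD 𝒟 h𝒟 τ Φ hsm hemb hJ hach hnorm ↦ ?_⟩
  exact H X D hD 𝒟 h𝒟 τ Φ hsm hemb hJ hach
    ((Literature.Geometry.Lorentzian.Spacetime.recedingKerrInitialLayerNorm_mono _ _ _ _ _ _ _
      (by norm_num : (2 : ℕ) ≤ 3) _ _ Φ).trans hnorm)

/-- The Repair-B order-3 hand-over property implies the filed clause bundle pointwise, hence `ThriftyHandoffB₃` implies
the filed `ThriftyHandoff` (tame codimension is antitone in the exceptional set): forget `Φₑ` and the tie, weaken the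
order of the layer norm.  [cite: Christodoulou1999, p. A24] -/
theorem thriftyHandoff_of_B₃ (h : ThriftyHandoffB₃) : Theses.DerivativeThrift.ThriftyHandoff := by
  intro X _ _ _ _ _ _
  have mono : ∀ {𝓓 : Set (Literature.Geometry.Lorentzian.InitialDataSet (𝓡 3) X)}
      {Q P : Literature.Geometry.Lorentzian.InitialDataSet (𝓡 3) X → Prop},
      (∀ D ∈ 𝓓, Q D → P D) →
        Literature.Geometry.Lorentzian.InitialDataSet.IsTameChristodoulouGeneric 𝓓 Q 1 →
          Literature.Geometry.Lorentzian.InitialDataSet.IsTameChristodoulouGeneric 𝓓 P 1 := by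
    intro 𝓓 Q P hQP hQ D hD
    obtain ⟨e, F, hF, himm, h0, hinj, hadm, hgood⟩ := hQ D ⟨hD.1, fun h ↦ hD.2 (hQP D hD.1 h)⟩
    exact ⟨e, F, hF, himm, h0, hinj, hadm,
      fun c hc hmem ↦ hgood c hc ⟨hmem.1, fun h ↦ hmem.2 (hQP _ hmem.1 h)⟩⟩
  refine mono ?_ (h X)
  intro D hD hQ
  dsimp only at hQ ⊢
  refine ⟨hQ.1, fun 𝒟 h𝒟 ↦ ⟨(hQ.2 𝒟 h𝒟).1, (hQ.2 𝒟 h𝒟).2.1, ?_⟩⟩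
  obtain ⟨N, M, a, Λ, hsub, horth, hvel, θ, τₑ, V, Φₑ, hθ, hV, hlate, hdev, hfut, hlayers⟩ := (hQ.2 𝒟 h𝒟).2.2
  refine ⟨N, M, a, Λ, hsub, horth, hvel, fun ℓ hℓ ε hε τ₁ ↦ ?_⟩
  obtain ⟨τ, hτ, ξ, Φ, hsep, hsm, hemb, hJ, hach, hnorm, -⟩ := hlayers ℓ hℓ ε hε τ₁
  exact ⟨τ, hτ, ξ, Φ, hsep, hsm, hemb, hJ, hach,
    (Literature.Geometry.Lorentzian.Spacetime.recedingKerrInitialLayerNorm_mono _ _ _ _ _ _ _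
      (by norm_num : (2 : ℕ) ≤ 3) _ _ Φ).trans hnorm⟩

/-- `ThriftyClusterSettlingB₃` follows from `RepairA₃` (its antecedent contains an order-3 hand-over and an outer-flatness
certificate; the one-atlas tie is forgotten) — so the registered line, re-typed, closes the Repair-B restatement.
[cite: DafermosLuk2017, Conjecture 1] -/
theorem thriftyClusterSettlingB₃_of_repairA₃ (h : RepairA₃) : ThriftyClusterSettlingB₃ := by
  intro hK X _ _ _ _ _ _ D hD 𝒟 h𝒟 h𝓘 hB
  obtain ⟨N, M, a, Λ, hsub, horth, hvel, θ, τₑ, V, Φₑ, hθ, hV, hlate, hdev, hfut, hlayers⟩ := hB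
  refine h hK X D hD 𝒟 h𝒟 h𝓘 ⟨N, M, a, Λ, hsub, horth, hvel, ?_⟩ ⟨θ, τₑ, V, Φₑ, hθ, hV, hlate, hdev, hfut⟩
  intro ℓ hℓ ε hε τ₁
  obtain ⟨τ, hτ, ξ, Φ, hsep, hsm, hemb, hJ, hach, hnorm, -⟩ := hlayers ℓ hℓ ε hε τ₁
  exact ⟨τ, hτ, ξ, Φ, hsep, hsm, hemb, hJ, hach, hnorm⟩

/-- **The deciding theorem survives the restatement**: `ThriftyKerrStability₃ → ThriftyClusterSettlingB₃ →
ThriftyHandoffB₃ → FinalStateConjecture`, by the route's own glue (tame codimension antitone; the endgame turns the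
Repair-B hand-over into the honest decomposition; the ray clause instantiated at it).  [cite: Christodoulou1999, p. A24] -/
theorem closesB₃ (h1 : ThriftyKerrStability₃) (h2 : ThriftyClusterSettlingB₃) (h3 : ThriftyHandoffB₃) :
    FinalStateConjecture := by
  intro X _ _ _ _ _ _
  have mono : ∀ {𝓓 : Set (Literature.Geometry.Lorentzian.InitialDataSet (𝓡 3) X)}
      {Q P : Literature.Geometry.Lorentzian.InitialDataSet (𝓡 3) X → Prop},
      (∀ D ∈ 𝓓, Q D → P D) →
        Literature.Geometry.Lorentzian.InitialDataSet.IsTameChristodoulouGeneric 𝓓 Q 1 →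
          Literature.Geometry.Lorentzian.InitialDataSet.IsTameChristodoulouGeneric 𝓓 P 1 := by
    intro 𝓓 Q P hQP hQ D hD
    obtain ⟨e, F, hF, himm, h0, hinj, hadm, hgood⟩ := hQ D ⟨hD.1, fun h ↦ hD.2 (hQP D hD.1 h)⟩
    exact ⟨e, F, hF, himm, h0, hinj, hadm,
      fun c hc hmem ↦ hgood c hc ⟨hmem.1, fun h ↦ hmem.2 (hQP _ hmem.1 h)⟩⟩
  refine mono ?_ (h3 X)
  intro D hD hQ
  dsimp only at hQ ⊢
  refine ⟨hQ.1, fun 𝒟 h𝒟 ↦ ⟨(hQ.2 𝒟 h𝒟).1, ?_⟩⟩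
  obtain ⟨O, d, hsub, hO, hex, hfo⟩ := h2 h1 X D hD 𝒟 h𝒟 (hQ.2 𝒟 h𝒟).1 (hQ.2 𝒟 h𝒟).2.2
  exact ⟨O, d, hsub, hO, (hQ.2 𝒟 h𝒟).2.1 O d hsub hO hex hfo, hex, hfo⟩

/-! ### Anti-vacuity of the restated crux: its hypothesis block AND its conclusion hold at the Minkowski development -/

/-- **The Repair-B order-3 hand-over (the antecedent of `ThriftyClusterSettlingB₃`, clause (iii) of
`ThriftyHandoffB₃`) HOLDS at the Minkowski development of the trivial datum**: `N = 0`; outer chart = the identity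
flat chart of the honest `N = 0` decomposition `minkowskiDecomp` on `V = ⊤` (a late chart into `{x⁰ ≥ 0} ⊆ J⁺(ι ℝ³)`,
deviation identically `0`, `∂₀ ↦ ∂ₜ`), aperture `θ = 1/2`, `τₑ = 0`; layers = the inclusions of the exact `0`-hole
layers (`𝔑 = 0` at every order, `recedingKerrInitialLayerNorm_subtypeVal_layer`), which agree with the identity chart
everywhere, in particular on the cone complement (the one-atlas tie holds by `rfl`).  So the restated antecedent is
satisfiable — the restatement does not make the crux vacuous.  [cite: KlainermanSzeftel2023, §3.1] -/
theorem repairBHandover₃_minkowski :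
    ∃ (N : ℕ) (M a : Fin N → ℝ) (Λ : Fin N → ↥Literature.Geometry.Lorentzian.lorentzGroup), (∀ i, Literature.Geometry.Lorentzian.Kerr.IsSubextremal (M i) (a i)) ∧ (∀ i, Summit.FinalStateConjecture.IsOrthochronous (Λ i)) ∧ (∀ i j, i ≠ j → (((Λ i : Literature.Geometry.Lorentzian.E4 ≃L[ℝ] Literature.Geometry.Lorentzian.E4) (Literature.Geometry.Lorentzian.E4.basisVector 0)) 0)⁻¹ • Literature.Geometry.Lorentzian.E4.spatial ((Λ i : Literature.Geometry.Lorentzian.E4 ≃L[ℝ] Literature.Geometry.Lorentzian.E4) (Literature.Geometry.Lorentzian.E4.basisVector 0)) ≠ (((Λ j : Literature.Geometry.Lorentzian.E4 ≃L[ℝ] Literature.Geometry.Lorentzian.E4) (Literature.Geometry.Lorentzian.E4.basisVector 0)) 0)⁻¹ • Literature.Geometry.Lorentzian.E4.spatial ((Λ j : Literature.Geometry.Lorentzian.E4 ≃L[ℝ] Literature.Geometry.Lorentzian.E4) (Literature.Geometry.Lorentzian.E4.basisVector 0))) ∧ ∃ (θ τₑ : ℝ) (V : TopologicalSpace.Opens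 Literature.Geometry.Lorentzian.E4) (Φₑ : V → Literature.Geometry.Lorentzian.Minkowski.vacuumCauchyDevelopment.carrier), 0 < θ ∧ {x : Literature.Geometry.Lorentzian.E4 | τₑ < x 0 ∧ (1 - θ) * x 0 < Literature.Geometry.Lorentzian.E4.spatialNorm x} ⊆ (V : Set Literature.Geometry.Lorentzian.E4) ∧ Literature.Geometry.Lorentzian.Minkowski.vacuumCauchyDevelopment.toSpacetime.IsLateChart (Literature.Geometry.Lorentzian.Minkowski.backgroundOn V) (Literature.Geometry.Lorentzian.Minkowski.vacuumCauchyDevelopment.metric.causalFuture Literature.Geometry.Lorentzian.Minkowski.vacuumCauchyDevelopment.timeOrientation (Set.range Literature.Geometry.Lorentzian.Minkowski.vacuumCauchyDevelopment.embed)) τₑ Φₑ ∧ Filter.Tendsto (fun τ ↦ Literature.Geometry.Lorentzian.Minkowski.vacuumCauchyDevelopment.toSpacetime.deviationCk (Literature.Geometry.Lorentzian.Minkowski.backgroundOn V) Φₑ 2 τ) Filter.atTop (nhds 0) ∧ (∀ᶠ τ in Filter.atTop, ∀ x ∈ (Literature.Geometry.Lorentzian.Minkowski.backgroundOn V).timeSlab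 τ, Literature.Geometry.Lorentzian.Minkowski.vacuumCauchyDevelopment.timeOrientation.IsFutureDirected (mfderiv 𝓘(ℝ, Literature.Geometry.Lorentzian.E4) (𝓡 4) Φₑ x (Literature.Geometry.Lorentzian.E4.basisVector 0))) ∧ ∀ ℓ : ℝ, 0 < ℓ → ∀ ε : ℝ, 0 < ε → ∀ τ₁ : ℝ, ∃ τ : ℝ, τ₁ ≤ τ ∧ ∃ (ξ : Fin N → Literature.Geometry.Lorentzian.E3) (Φ : Literature.Geometry.Lorentzian.RecedingKerr.layer M a Λ ξ τ ℓ → Literature.Geometry.Lorentzian.Minkowski.vacuumCauchyDevelopment.carrier), (∀ i j, i ≠ j → ε⁻¹ ≤ ‖ξ i - ξ j‖ ∧ 0 ≤ @inner ℝ Literature.Geometry.Lorentzian.E3 _ (ξ i - ξ j) ( (((Λ i : Literature.Geometry.Lorentzian.E4 ≃L[ℝ] Literature.Geometry.Lorentzian.E4) (Literature.Geometry.Lorentzian.E4.basisVector 0)) 0)⁻¹ • Literature.Geometry.Lorentzian.E4.spatial ((Λ i : Literature.Geometry.Lorentzian.E4 ≃L[ℝ] Literature.Geometry.Lorentzian.E4)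 (Literature.Geometry.Lorentzian.E4.basisVector 0)) - (((Λ j : Literature.Geometry.Lorentzian.E4 ≃L[ℝ] Literature.Geometry.Lorentzian.E4) (Literature.Geometry.Lorentzian.E4.basisVector 0)) 0)⁻¹ • Literature.Geometry.Lorentzian.E4.spatial ((Λ j : Literature.Geometry.Lorentzian.E4 ≃L[ℝ] Literature.Geometry.Lorentzian.E4) (Literature.Geometry.Lorentzian.E4.basisVector 0)))) ∧ ContMDiff 𝓘(ℝ, Literature.Geometry.Lorentzian.E4) (𝓡 4) ((⊤ : ℕ∞) : WithTop ℕ∞) Φ ∧ Topology.IsOpenEmbedding Φ ∧ Set.range Φ ⊆ Literature.Geometry.Lorentzian.Minkowski.vacuumCauchyDevelopment.metric.causalFuture Literature.Geometry.Lorentzian.Minkowski.vacuumCauchyDevelopment.timeOrientation (Set.range Literature.Geometry.Lorentzian.Minkowski.vacuumCauchyDevelopment.embed) ∧ (∀ s₀ ∈ Set.Ioo 0 ℓ, Literature.Geometry.Lorentzian.Minkowski.vacuumCauchyDevelopment.metric.IsAchronal Literature.Geometry.Lorentzian.Minkowski.vacuumCauchyDevelopment.timeOrientation (Φ '' {x |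 Literature.Geometry.Lorentzian.RecedingKerr.layerTime τ ℓ x.1 = s₀})) ∧ Literature.Geometry.Lorentzian.Minkowski.vacuumCauchyDevelopment.toSpacetime.recedingKerrInitialLayerNorm M a Λ ξ τ ℓ 3 (1 / 2) (1 / 2) Φ ≤ ENNReal.ofReal ε ∧ (∀ x : Literature.Geometry.Lorentzian.RecedingKerr.layer M a Λ ξ τ ℓ, τₑ < x.1 0 → (1 - θ) * x.1 0 < Literature.Geometry.Lorentzian.E4.spatialNorm x.1 → ∃ hx : x.1 ∈ V, Φ x = Φₑ ⟨x.1, hx⟩) := by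
  have hOS : Theorems.UniversalWitnessFamily.Negative.minkowskiExterior ⊆
      Literature.Geometry.Lorentzian.Minkowski.vacuumCauchyDevelopment.metric.causalFuture Literature.Geometry.Lorentzian.Minkowski.vacuumCauchyDevelopment.timeOrientation (Set.range Literature.Geometry.Lorentzian.Minkowski.vacuumCauchyDevelopment.embed) := by
    rw [Theorems.UniversalWitnessFamily.Negative.minkowskiExterior_eq_exteriorOf]
    exact Set.inter_subset_left
  refine ⟨0, ![], ![], ![], fun i ↦ i.elim0, fun i ↦ i.elim0, fun i ↦ i.elim0, 1 / 2, 0, ⊤,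
    Theorems.UniversalWitnessFamily.Negative.idFlatChart, one_half_pos, fun _ _ ↦ trivial, ?_, ?_, ?_, ?_⟩
  · -- the identity flat chart, re-based into `J⁺(ι ℝ³)`
    exact Theorems.DerivativeThrift.ThriftyClusterSettling.isLateChart_backgroundOn_of_le
      Theorems.UniversalWitnessFamily.Negative.isLateChart_idFlatChart le_rfl hOS
  · -- zero deviation
    exact Theorems.UniversalWitnessFamily.Negative.minkowskiDecomp.tendsto_deviationCk_flat
  · -- `∂₀ ↦ ∂ₜ`
    exact Theorems.ChannelsResolveTameDevelopmentsR.TrivialDatum.isFutureOriented_minkowskiDecomp.2.2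
  · -- exact `0`-hole layers after any `τ₁`, tied to the identity chart
    intro ℓ hℓ ε hε τ₁
    refine ⟨max τ₁ 0, le_max_left _ _, ![],
      (Subtype.val : Literature.Geometry.Lorentzian.RecedingKerr.layer (![] : Fin 0 → ℝ) ![] ![] ![] (max τ₁ 0) ℓ →
        Literature.Geometry.Lorentzian.E4),
      fun i ↦ i.elim0, contMDiff_subtype_val,
      (Literature.Geometry.Lorentzian.RecedingKerr.layer (![] : Fin 0 → ℝ) ![] ![] ![] (max τ₁ 0) ℓ).isOpen.isOpenEmbedding_subtypeVal,
      Theorems.DerivativeThriftThriftyHandoff.range_subtypeVal_layer_subset_causalFuture ![] ![] ![] ![] (le_max_right _ _),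
      fun s₀ _ ↦ Theorems.DerivativeThriftThriftyHandoff.isAchronal_image_subtypeVal_leaf ![] ![] ![] ![] (max τ₁ 0) hℓ s₀,
      ?_, fun x _ _ ↦ ⟨trivial, rfl⟩⟩
    rw [Theorems.DerivativeThriftThriftyHandoff.recedingKerrInitialLayerNorm_subtypeVal_layer]
    exact bot_le

/-- **Every hypothesis of the restated crux `ThriftyClusterSettlingB₃` AND its conclusion hold simultaneously at ONE
certified maximal development of an admissible datum** (given the Choquet-Bruhat–Geroch existence theorem for
maximality of Minkowski space): the trivial datum is admissible, Minkowski space is its MGHD with complete `𝓘⁺`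
(`cruxHypotheses_minkowski`), the Repair-B order-3 hand-over holds (`repairBHandover₃_minkowski`), and the exterior
settles in the re-typed sense (`settlesT2_minkowski`).  [cite: ChristodoulouKlainerman1993, Thm. 1.0.2] -/
theorem restatedCruxHypotheses_and_consequent_minkowski
    (hcbg : Literature.Geometry.Lorentzian.choquetBruhat_geroch_exists_mghd_cauchy) :
    Literature.Geometry.Lorentzian.trivialData ∈
        Literature.Geometry.Lorentzian.admissibleVacuumData Literature.Geometry.Lorentzian.Minkowski.slice ∧
      Literature.Geometry.Lorentzian.Minkowski.vacuumCauchyDevelopment.IsMaximal ∧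
      Summit.FinalStateConjecture.HasCompleteNullInfinity Literature.Geometry.Lorentzian.Minkowski.vacuumCauchyDevelopment.toCauchyDevelopment ∧
      (∃ (N : ℕ) (M a : Fin N → ℝ) (Λ : Fin N → ↥Literature.Geometry.Lorentzian.lorentzGroup), (∀ i, Literature.Geometry.Lorentzian.Kerr.IsSubextremal (M i) (a i)) ∧ (∀ i, Summit.FinalStateConjecture.IsOrthochronous (Λ i)) ∧ (∀ i j, i ≠ j → (((Λ i : Literature.Geometry.Lorentzian.E4 ≃L[ℝ] Literature.Geometry.Lorentzian.E4) (Literature.Geometry.Lorentzian.E4.basisVector 0)) 0)⁻¹ • Literature.Geometry.Lorentzian.E4.spatial ((Λ i : Literature.Geometry.Lorentzian.E4 ≃L[ℝ] Literature.Geometry.Lorentzian.E4) (Literature.Geometry.Lorentzian.E4.basisVector 0)) ≠ (((Λ j : Literature.Geometry.Lorentzian.E4 ≃L[ℝ] Literature.Geometry.Lorentzian.E4) (Literature.Geometry.Lorentzian.E4.basisVector 0)) 0)⁻¹ • Literature.Geometry.Lorentzian.E4.spatial ((Λ j : Literature.Geometry.Lorentzian.E4 ≃L[ℝ] Literature.Geometry.Lorentzian.E4)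 (Literature.Geometry.Lorentzian.E4.basisVector 0))) ∧ ∃ (θ τₑ : ℝ) (V : TopologicalSpace.Opens Literature.Geometry.Lorentzian.E4) (Φₑ : V → Literature.Geometry.Lorentzian.Minkowski.vacuumCauchyDevelopment.carrier), 0 < θ ∧ {x : Literature.Geometry.Lorentzian.E4 | τₑ < x 0 ∧ (1 - θ) * x 0 < Literature.Geometry.Lorentzian.E4.spatialNorm x} ⊆ (V : Set Literature.Geometry.Lorentzian.E4) ∧ Literature.Geometry.Lorentzian.Minkowski.vacuumCauchyDevelopment.toSpacetime.IsLateChart (Literature.Geometry.Lorentzian.Minkowski.backgroundOn V) (Literature.Geometry.Lorentzian.Minkowski.vacuumCauchyDevelopment.metric.causalFuture Literature.Geometry.Lorentzian.Minkowski.vacuumCauchyDevelopment.timeOrientation (Set.range Literature.Geometry.Lorentzian.Minkowski.vacuumCauchyDevelopment.embed)) τₑ Φₑ ∧ Filter.Tendsto (fun τ ↦ Literature.Geometry.Lorentzian.Minkowski.vacuumCauchyDevelopment.toSpacetime.deviationCk (Literature.Geometry.Lorentzian.Minkowski.backgroundOn V) Φₑ 2 τ) Filter.atTop (nhds 0) ∧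 (∀ᶠ τ in Filter.atTop, ∀ x ∈ (Literature.Geometry.Lorentzian.Minkowski.backgroundOn V).timeSlab τ, Literature.Geometry.Lorentzian.Minkowski.vacuumCauchyDevelopment.timeOrientation.IsFutureDirected (mfderiv 𝓘(ℝ, Literature.Geometry.Lorentzian.E4) (𝓡 4) Φₑ x (Literature.Geometry.Lorentzian.E4.basisVector 0))) ∧ ∀ ℓ : ℝ, 0 < ℓ → ∀ ε : ℝ, 0 < ε → ∀ τ₁ : ℝ, ∃ τ : ℝ, τ₁ ≤ τ ∧ ∃ (ξ : Fin N → Literature.Geometry.Lorentzian.E3) (Φ : Literature.Geometry.Lorentzian.RecedingKerr.layer M a Λ ξ τ ℓ → Literature.Geometry.Lorentzian.Minkowski.vacuumCauchyDevelopment.carrier), (∀ i j, i ≠ j → ε⁻¹ ≤ ‖ξ i - ξ j‖ ∧ 0 ≤ @inner ℝ Literature.Geometry.Lorentzian.E3 _ (ξ i - ξ j) ( (((Λ i : Literature.Geometry.Lorentzian.E4 ≃L[ℝ] Literature.Geometry.Lorentzian.E4) (Literature.Geometry.Lorentzian.E4.basisVector 0)) 0)⁻¹ • Literature.Geometry.Lorentzian.E4.spatial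 ((Λ i : Literature.Geometry.Lorentzian.E4 ≃L[ℝ] Literature.Geometry.Lorentzian.E4) (Literature.Geometry.Lorentzian.E4.basisVector 0)) - (((Λ j : Literature.Geometry.Lorentzian.E4 ≃L[ℝ] Literature.Geometry.Lorentzian.E4) (Literature.Geometry.Lorentzian.E4.basisVector 0)) 0)⁻¹ • Literature.Geometry.Lorentzian.E4.spatial ((Λ j : Literature.Geometry.Lorentzian.E4 ≃L[ℝ] Literature.Geometry.Lorentzian.E4) (Literature.Geometry.Lorentzian.E4.basisVector 0)))) ∧ ContMDiff 𝓘(ℝ, Literature.Geometry.Lorentzian.E4) (𝓡 4) ((⊤ : ℕ∞) : WithTop ℕ∞) Φ ∧ Topology.IsOpenEmbedding Φ ∧ Set.range Φ ⊆ Literature.Geometry.Lorentzian.Minkowski.vacuumCauchyDevelopment.metric.causalFuture Literature.Geometry.Lorentzian.Minkowski.vacuumCauchyDevelopment.timeOrientation (Set.range Literature.Geometry.Lorentzian.Minkowski.vacuumCauchyDevelopment.embed) ∧ (∀ s₀ ∈ Set.Ioo 0 ℓ, Literature.Geometry.Lorentzian.Minkowski.vacuumCauchyDevelopment.metric.IsAchronal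 Literature.Geometry.Lorentzian.Minkowski.vacuumCauchyDevelopment.timeOrientation (Φ '' {x | Literature.Geometry.Lorentzian.RecedingKerr.layerTime τ ℓ x.1 = s₀})) ∧ Literature.Geometry.Lorentzian.Minkowski.vacuumCauchyDevelopment.toSpacetime.recedingKerrInitialLayerNorm M a Λ ξ τ ℓ 3 (1 / 2) (1 / 2) Φ ≤ ENNReal.ofReal ε ∧ (∀ x : Literature.Geometry.Lorentzian.RecedingKerr.layer M a Λ ξ τ ℓ, τₑ < x.1 0 → (1 - θ) * x.1 0 < Literature.Geometry.Lorentzian.E4.spatialNorm x.1 → ∃ hx : x.1 ∈ V, Φ x = Φₑ ⟨x.1, hx⟩)) ∧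
      ∃ (O : Set Literature.Geometry.Lorentzian.Minkowski.vacuumCauchyDevelopment.carrier) (d : Literature.Geometry.Lorentzian.FinalStateDecomposition Literature.Geometry.Lorentzian.Minkowski.vacuumCauchyDevelopment.toSpacetime O 2), (∀ i, Literature.Geometry.Lorentzian.Kerr.IsSubextremal (d.mass i) (d.spin i)) ∧ O = Summit.FinalStateConjecture.exteriorOf Literature.Geometry.Lorentzian.Minkowski.vacuumCauchyDevelopment.toCauchyDevelopment d.charted ∧ Summit.FinalStateConjecture.HasExhaustiveCharts d ∧ Summit.FinalStateConjecture.IsFutureOriented d := by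
  obtain ⟨hD, hmax, hscri, -, -, -⟩ := Theorems.ChannelsResolveTameDevelopmentsR.TrivialDatum.cruxHypotheses_minkowski hcbg
  obtain ⟨-, O, d, hsub, hO, -, hex, hfo⟩ := Theorems.ChannelsResolveTameDevelopmentsR.TrivialDatum.settlesT2_minkowski
  exact ⟨hD, hmax, hscri, repairBHandover₃_minkowski, O, d, hsub, hO, hex, hfo⟩

end Summit.FinalStateConjecture.FinalStateConjecture.Cruxes.ThriftyClusterSettling.Restatement

end
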